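import Summits.RiemannHypothesis.RiemannHypothesis.Theorems.JensenPolynomialsSkewFarDelta

/-!
# Route `JensenPolynomials`, FAR crux `XiCumulantSkew98Far` — part 5b: the delta method, second and third moments
(RH-FREE; cell rh-jensen, HUMAN RULING D-0040)

Continuation of `JensenPolynomialsSkewFarDelta.lean`: with `a = a_s`, `y = (u−a)/a`, `I_n = ∫Φu^s(u−a)^n`, a free scale
`λ > 0` (later `λ = 1/√s`) and the left-region bound of part 5a,

* `J2_bound`: `|M_{s−4} − 2M_{s−2}/a² + M_s/a⁴ − 4I₂/a⁶| ≤ (2/a)⁴(6λI₂/a² + (6/λ + 23 + 8λ)I₄/a⁴ + (8/λ + 4)I₆/a⁶) + 55·L₄`,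
* `J3_bound`: `|M_{s−6} − 3M_{s−4}/a² + 3M_{s−2}/a⁴ − M_s/a⁶ − (−8I₃/a³ + 36I₄/a⁴)/a⁶|
   ≤ (2/a)⁶(51λI₄/a⁴ + (51/λ + 381 + 300λ)I₆/a⁶ + (300/λ + 492 + 104λ)I₈/a⁸ + (104/λ + 36)I₁₀/a¹⁰) + 1819·L₆`,

`L_j = (a/2)/(a/2)^j·(4/a)⁷I₆`. WHAT THIS IS NOT: nothing here bears on the zeros of `ζ`.
References: delta method (folklore); [CoffeyCsordas2013]; [GORZPNAS2019].
-/

noncomputable section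
-- D-0017: `Summit.RiemannHypothesis.RiemannHypothesis.…` duplicates the namespace BY DESIGN (single-problem summit).
set_option linter.dupNamespace false

namespace Summit.RiemannHypothesis.RiemannHypothesis.Theorems.JensenPolynomials.SkewFar

open Literature.NumberTheory.LFunctions Literature.Probability.Distributions MeasureTheory Set Filter Real
open scoped Topology Nat

/-- `|y| ≤ 1` on the left region `u ∈ (0, a/2)` (`y = (u − a)/a`). -/
theorem abs_y_le_one {a u : ℝ} (ha : 0 < a) (hu : u ∈ Ioo 0 (a / 2)) : |(u - a) / a| ≤ 1 := by
  rw [abs_div, abs_of_pos ha, div_le_one ha, abs_le]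
  constructor <;> linarith [hu.1, hu.2]

/-- **J₂.** -/
theorem J2_bound (s : ℕ) (hs : 4 * 10 ^ 18 ≤ s) {lam : ℝ} (hl : 0 < lam) :
    |xiMoment (s - 4) - 2 * xiMoment (s - 2) / xiMode (s : ℝ) ^ 2 + xiMoment s / xiMode (s : ℝ) ^ 4 -
        4 * xiAbsMoment s 2 (xiMode (s : ℝ)) / xiMode (s : ℝ) ^ 6| ≤
      (2 / xiMode (s : ℝ)) ^ 4 * (6 * lam / xiMode (s : ℝ) ^ 2 * xiAbsMoment s 2 (xiMode (s : ℝ)) +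
        (6 / lam + 23 + 8 * lam) / xiMode (s : ℝ) ^ 4 * xiAbsMoment s 4 (xiMode (s : ℝ)) +
        (8 / lam + 4) / xiMode (s : ℝ) ^ 6 * xiAbsMoment s 6 (xiMode (s : ℝ))) +
      55 * ((xiMode (s : ℝ) / 2) / (xiMode (s : ℝ) / 2) ^ 4 * ((4 / xiMode (s : ℝ)) ^ 7 * xiAbsMoment s 6 (xiMode (s : ℝ)))) := by
  obtain ⟨ha0, _, _, _⟩ := mode_facts s hs
  set a := xiMode (s : ℝ) with ha_def
  have hs4 : 4 ≤ s := le_trans (by norm_num) hs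
  have hs2 : 2 ≤ s := le_trans (by norm_num) hs
  have hI := fun n => integrableOn_deBruijnPhi_mul_pow_mul_sub_pow s n a
  set r : ℝ → ℝ := fun u => -((u - a) / a) ^ 3 * (12 + 23 * ((u - a) / a) + 16 * ((u - a) / a) ^ 2 +
    4 * ((u - a) / a) ^ 3) with hr
  have hid : xiMoment (s - 4) - 2 * xiMoment (s - 2) / a ^ 2 + xiMoment s / a ^ 4 - 4 * xiAbsMoment s 2 a / a ^ 6 =
      ∫ u in Ioi 0, deBruijnPhi u * u ^ (s - 4) * r u := by
    have e2 : xiAbsMoment s 2 a = ∫ u in Ioi 0, deBruijnPhi u * u ^ s * (u - a) ^ 2 := by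
      simpa using xiAbsMoment_even s 1 a
    rw [e2, xiMoment, xiMoment, xiMoment]
    have hpt : ∀ u ∈ Ioi (0 : ℝ), deBruijnPhi u * u ^ (s - 4) * r u =
        deBruijnPhi u * u ^ (s - 4) - (2 / a ^ 2) * (deBruijnPhi u * u ^ (s - 2)) + (1 / a ^ 4) * (deBruijnPhi u * u ^ s) -
        (4 / a ^ 6) * (deBruijnPhi u * u ^ s * (u - a) ^ 2) := by
      intro u (hu : 0 < u)
      have hid := delta_id_two ha0.ne' hu.ne'
      have hus : u ^ s = u ^ (s - 4) * u ^ 4 := by rw [← pow_add, Nat.sub_add_cancel hs4]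
      have hus2 : u ^ (s - 2) = u ^ (s - 4) * u ^ 2 := by rw [← pow_add]; congr 1; omega
      simp only [hr]
      rw [hus, hus2]
      have hu2 : u ^ 2 ≠ 0 := pow_ne_zero 2 hu.ne'
      have hu4 : u ^ 4 ≠ 0 := pow_ne_zero 4 hu.ne'
      field_simp
      field_simp at hid
      linear_combination deBruijnPhi u * u ^ (s - 4) * hid
    rw [setIntegral_congr_fun measurableSet_Ioi hpt, integral_sub, integral_add, integral_sub, integral_const_mul,
      integral_const_mul, integral_const_mul]
    · ring
    · exact integrableOn_deBruijnPhi_mul_pow (s - 4)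
    · exact (integrableOn_deBruijnPhi_mul_pow (s - 2)).const_mul _
    · exact (integrableOn_deBruijnPhi_mul_pow (s - 4)).sub ((integrableOn_deBruijnPhi_mul_pow (s - 2)).const_mul _)
    · exact (integrableOn_deBruijnPhi_mul_pow s).const_mul _
    · exact ((integrableOn_deBruijnPhi_mul_pow (s - 4)).sub ((integrableOn_deBruijnPhi_mul_pow (s - 2)).const_mul _)).add
        ((integrableOn_deBruijnPhi_mul_pow s).const_mul _)
    · exact (hI 2).const_mul _
  rw [hid]
  have hmaj : ∀ u : ℝ, a / 2 ≤ u → |r u| ≤ 0 + 6 * lam / a ^ 2 * (u - a) ^ 2 + (6 / lam + 23 + 8 * lam) / a ^ 4 * (u - a) ^ 4 +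
      (8 / lam + 4) / a ^ 6 * (u - a) ^ 6 + 0 * (u - a) ^ 8 + 0 * (u - a) ^ 10 := by
    intro u _
    simp only [hr]
    set y := (u - a) / a with hy
    have h2 : 0 ≤ y ^ 2 := by positivity
    have h4 : 0 ≤ y ^ 4 := by positivity
    have h6 : 0 ≤ y ^ 6 := by positivity
    have ham3 := amgm_y (y := y) hl h2
    have ham5 := amgm_y (y := y) hl h4
    have e : y = (u - a) * a⁻¹ := by rw [hy, div_eq_mul_inv]
    have e3 : |y ^ 3| = y ^ 2 * |y| := by rw [abs_pow, pow_succ, Even.pow_abs (by decide : Even 2)]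
    have e5 : |y ^ 5| = y ^ 4 * |y| := by rw [abs_pow, pow_succ, Even.pow_abs (by decide : Even 4)]
    have hy1 : |y| = |y| := rfl
    calc |-y ^ 3 * (12 + 23 * y + 16 * y ^ 2 + 4 * y ^ 3)|
        = |12 * y ^ 3 + 23 * y ^ 4 + 16 * y ^ 5 + 4 * y ^ 6| := by
          rw [show -y ^ 3 * (12 + 23 * y + 16 * y ^ 2 + 4 * y ^ 3) = -(12 * y ^ 3 + 23 * y ^ 4 + 16 * y ^ 5 + 4 * y ^ 6)
            by ring, abs_neg]
      _ ≤ |12 * y ^ 3| + |23 * y ^ 4| + |16 * y ^ 5| + |4 * y ^ 6| := by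
          refine (abs_add_le _ _).trans ?_
          gcongr
          refine (abs_add_le _ _).trans ?_
          gcongr
          exact abs_add_le _ _
      _ = 12 * (y ^ 2 * |y|) + 23 * y ^ 4 + 16 * (y ^ 4 * |y|) + 4 * y ^ 6 := by
          rw [abs_mul, abs_mul, abs_mul, abs_mul, abs_of_pos (by norm_num : (0:ℝ) < 12),
            abs_of_pos (by norm_num : (0:ℝ) < 23), abs_of_pos (by norm_num : (0:ℝ) < 16),
            abs_of_pos (by norm_num : (0:ℝ) < 4), e3, e5, abs_of_nonneg h4, abs_of_nonneg h6]
      _ ≤ 12 * ((lam * y ^ 2 + y ^ 2 * y ^ 2 / lam) / 2) + 23 * y ^ 4 + 16 * ((lam * y ^ 4 + y ^ 4 * y ^ 2 / lam) / 2) +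
          4 * y ^ 6 := by linarith
      _ = 0 + 6 * lam / a ^ 2 * (u - a) ^ 2 + (6 / lam + 23 + 8 * lam) / a ^ 4 * (u - a) ^ 4 +
          (8 / lam + 4) / a ^ 6 * (u - a) ^ 6 + 0 * (u - a) ^ 8 + 0 * (u - a) ^ 10 := by
          rw [e]; field_simp; ring
  have hsup : ∀ u ∈ Ioo 0 (a / 2), |r u| ≤ 55 := by
    intro u hu
    simp only [hr]
    set y := (u - a) / a with hy
    have hy1 : |y| ≤ 1 := abs_y_le_one ha0 hu
    have hy0 := abs_nonneg y
    have hp : ∀ n : ℕ, |y| ^ n ≤ 1 := fun n => pow_le_one₀ hy0 hy1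
    calc |-y ^ 3 * (12 + 23 * y + 16 * y ^ 2 + 4 * y ^ 3)|
        = |y| ^ 3 * |12 + 23 * y + 16 * y ^ 2 + 4 * y ^ 3| := by rw [abs_mul, abs_neg, abs_pow]
      _ ≤ 1 * (12 + 23 * |y| + 16 * |y| ^ 2 + 4 * |y| ^ 3) := by
          refine mul_le_mul (hp 3) ?_ (abs_nonneg _) (by norm_num)
          calc |12 + 23 * y + 16 * y ^ 2 + 4 * y ^ 3| ≤ |12 + 23 * y + 16 * y ^ 2| + |4 * y ^ 3| := abs_add_le _ _
            _ ≤ |12 + 23 * y| + |16 * y ^ 2| + |4 * y ^ 3| := by gcongr; exact abs_add_le _ _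
            _ ≤ |(12 : ℝ)| + |23 * y| + |16 * y ^ 2| + |4 * y ^ 3| := by gcongr; exact abs_add_le _ _
            _ = 12 + 23 * |y| + 16 * |y| ^ 2 + 4 * |y| ^ 3 := by
                rw [abs_of_pos (by norm_num : (0:ℝ) < 12), abs_mul, abs_mul, abs_mul,
                  abs_of_pos (by norm_num : (0:ℝ) < 23), abs_of_pos (by norm_num : (0:ℝ) < 16),
                  abs_of_pos (by norm_num : (0:ℝ) < 4), abs_pow, abs_pow]
      _ ≤ 55 := by nlinarith [hp 1, hp 2, hp 3]
  have h := remainder_integral_le s hs 4 (by norm_num) (r := r) le_rfl (by positivity) (by positivity) (by positivity)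
    le_rfl le_rfl hmaj hsup
  have hL := leftRegion_le s hs 4 (by norm_num)
  rw [← ha_def] at h hL
  simp only [zero_mul, zero_add, add_zero] at h
  calc |∫ u in Ioi 0, deBruijnPhi u * u ^ (s - 4) * r u|
      ≤ (2 / a) ^ 4 * (6 * lam / a ^ 2 * xiAbsMoment s 2 a + (6 / lam + 23 + 8 * lam) / a ^ 4 * xiAbsMoment s 4 a +
          (8 / lam + 4) / a ^ 6 * xiAbsMoment s 6 a) + 55 * ∫ u in Ioo 0 (a / 2), deBruijnPhi u * u ^ (s - 4) := h
    _ ≤ _ := by linarith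

/-- **J₃.** -/
theorem J3_bound (s : ℕ) (hs : 4 * 10 ^ 18 ≤ s) {lam : ℝ} (hl : 0 < lam) :
    |xiMoment (s - 6) - 3 * xiMoment (s - 4) / xiMode (s : ℝ) ^ 2 + 3 * xiMoment (s - 2) / xiMode (s : ℝ) ^ 4 -
        xiMoment s / xiMode (s : ℝ) ^ 6 -
        (-8 * (∫ u in Ioi 0, deBruijnPhi u * u ^ s * (u - xiMode (s : ℝ)) ^ 3) / xiMode (s : ℝ) ^ 3 +
          36 * xiAbsMoment s 4 (xiMode (s : ℝ)) / xiMode (s : ℝ) ^ 4) / xiMode (s : ℝ) ^ 6| ≤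
      (2 / xiMode (s : ℝ)) ^ 6 * (51 * lam / xiMode (s : ℝ) ^ 4 * xiAbsMoment s 4 (xiMode (s : ℝ)) +
        (51 / lam + 381 + 300 * lam) / xiMode (s : ℝ) ^ 6 * xiAbsMoment s 6 (xiMode (s : ℝ)) +
        (300 / lam + 492 + 104 * lam) / xiMode (s : ℝ) ^ 8 * xiAbsMoment s 8 (xiMode (s : ℝ)) +
        (104 / lam + 36) / xiMode (s : ℝ) ^ 10 * xiAbsMoment s 10 (xiMode (s : ℝ))) +
      1819 * ((xiMode (s : ℝ) / 2) / (xiMode (s : ℝ) / 2) ^ 6 * ((4 / xiMode (s : ℝ)) ^ 7 * xiAbsMoment s 6 (xiMode (s : ℝ)))) := by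
  obtain ⟨ha0, _, _, _⟩ := mode_facts s hs
  set a := xiMode (s : ℝ) with ha_def
  have hs6 : 6 ≤ s := le_trans (by norm_num) hs
  have hI := fun n => integrableOn_deBruijnPhi_mul_pow_mul_sub_pow s n a
  set r : ℝ → ℝ := fun u => -((u - a) / a) ^ 5 * (102 + 381 * ((u - a) / a) + 600 * ((u - a) / a) ^ 2 +
    492 * ((u - a) / a) ^ 3 + 208 * ((u - a) / a) ^ 4 + 36 * ((u - a) / a) ^ 5) with hr
  have hid : xiMoment (s - 6) - 3 * xiMoment (s - 4) / a ^ 2 + 3 * xiMoment (s - 2) / a ^ 4 - xiMoment s / a ^ 6 -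
      (-8 * (∫ u in Ioi 0, deBruijnPhi u * u ^ s * (u - a) ^ 3) / a ^ 3 + 36 * xiAbsMoment s 4 a / a ^ 4) / a ^ 6 =
      ∫ u in Ioi 0, deBruijnPhi u * u ^ (s - 6) * r u := by
    have e4 : xiAbsMoment s 4 a = ∫ u in Ioi 0, deBruijnPhi u * u ^ s * (u - a) ^ 4 := by
      simpa using xiAbsMoment_even s 2 a
    rw [e4, xiMoment, xiMoment, xiMoment, xiMoment]
    have hpt : ∀ u ∈ Ioi (0 : ℝ), deBruijnPhi u * u ^ (s - 6) * r u =
        deBruijnPhi u * u ^ (s - 6) - (3 / a ^ 2) * (deBruijnPhi u * u ^ (s - 4)) + (3 / a ^ 4) * (deBruijnPhi u * u ^ (s - 2)) -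
        (1 / a ^ 6) * (deBruijnPhi u * u ^ s) -
        ((-8 / a ^ 9) * (deBruijnPhi u * u ^ s * (u - a) ^ 3) + (36 / a ^ 10) * (deBruijnPhi u * u ^ s * (u - a) ^ 4)) := by
      intro u (hu : 0 < u)
      have hid := delta_id_three ha0.ne' hu.ne'
      have hus : u ^ s = u ^ (s - 6) * u ^ 6 := by rw [← pow_add, Nat.sub_add_cancel hs6]
      have hus2 : u ^ (s - 2) = u ^ (s - 6) * u ^ 4 := by rw [← pow_add]; congr 1; omega
      have hus4 : u ^ (s - 4) = u ^ (s - 6) * u ^ 2 := by rw [← pow_add]; congr 1; omega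
      simp only [hr]
      rw [hus, hus2, hus4]
      have hu2 : u ^ 2 ≠ 0 := pow_ne_zero 2 hu.ne'
      have hu4 : u ^ 4 ≠ 0 := pow_ne_zero 4 hu.ne'
      have hu6 : u ^ 6 ≠ 0 := pow_ne_zero 6 hu.ne'
      field_simp
      field_simp at hid
      linear_combination deBruijnPhi u * u ^ (s - 6) * hid
    rw [setIntegral_congr_fun measurableSet_Ioi hpt, integral_sub, integral_sub, integral_add, integral_sub,
      integral_add, integral_const_mul, integral_const_mul, integral_const_mul, integral_const_mul, integral_const_mul]
    · ring
    · exact (hI 3).const_mul _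
    · exact (hI 4).const_mul _
    · exact integrableOn_deBruijnPhi_mul_pow (s - 6)
    · exact (integrableOn_deBruijnPhi_mul_pow (s - 4)).const_mul _
    · exact (integrableOn_deBruijnPhi_mul_pow (s - 6)).sub ((integrableOn_deBruijnPhi_mul_pow (s - 4)).const_mul _)
    · exact (integrableOn_deBruijnPhi_mul_pow (s - 2)).const_mul _
    · exact ((integrableOn_deBruijnPhi_mul_pow (s - 6)).sub ((integrableOn_deBruijnPhi_mul_pow (s - 4)).const_mul _)).add
        ((integrableOn_deBruijnPhi_mul_pow (s - 2)).const_mul _)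
    · exact (integrableOn_deBruijnPhi_mul_pow s).const_mul _
    · exact (((integrableOn_deBruijnPhi_mul_pow (s - 6)).sub ((integrableOn_deBruijnPhi_mul_pow (s - 4)).const_mul _)).add
        ((integrableOn_deBruijnPhi_mul_pow (s - 2)).const_mul _)).sub ((integrableOn_deBruijnPhi_mul_pow s).const_mul _)
    · exact ((hI 3).const_mul _).add ((hI 4).const_mul _)
  rw [hid]
  have hmaj : ∀ u : ℝ, a / 2 ≤ u → |r u| ≤ 0 + 0 * (u - a) ^ 2 + 51 * lam / a ^ 4 * (u - a) ^ 4 +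
      (51 / lam + 381 + 300 * lam) / a ^ 6 * (u - a) ^ 6 + (300 / lam + 492 + 104 * lam) / a ^ 8 * (u - a) ^ 8 +
      (104 / lam + 36) / a ^ 10 * (u - a) ^ 10 := by
    intro u _
    simp only [hr]
    set y := (u - a) / a with hy
    have h4 : 0 ≤ y ^ 4 := by positivity
    have h6 : 0 ≤ y ^ 6 := by positivity
    have h8 : 0 ≤ y ^ 8 := by positivity
    have h10 : 0 ≤ y ^ 10 := by positivity
    have ham5 := amgm_y (y := y) hl h4
    have ham7 := amgm_y (y := y) hl h6
    have ham9 := amgm_y (y := y) hl h8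
    have e : y = (u - a) * a⁻¹ := by rw [hy, div_eq_mul_inv]
    have e5 : |y ^ 5| = y ^ 4 * |y| := by rw [abs_pow, pow_succ, Even.pow_abs (by decide : Even 4)]
    have e7 : |y ^ 7| = y ^ 6 * |y| := by rw [abs_pow, pow_succ, Even.pow_abs (by decide : Even 6)]
    have e9 : |y ^ 9| = y ^ 8 * |y| := by rw [abs_pow, pow_succ, Even.pow_abs (by decide : Even 8)]
    calc |-y ^ 5 * (102 + 381 * y + 600 * y ^ 2 + 492 * y ^ 3 + 208 * y ^ 4 + 36 * y ^ 5)|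
        = |102 * y ^ 5 + 381 * y ^ 6 + 600 * y ^ 7 + 492 * y ^ 8 + 208 * y ^ 9 + 36 * y ^ 10| := by
          rw [show -y ^ 5 * (102 + 381 * y + 600 * y ^ 2 + 492 * y ^ 3 + 208 * y ^ 4 + 36 * y ^ 5) =
            -(102 * y ^ 5 + 381 * y ^ 6 + 600 * y ^ 7 + 492 * y ^ 8 + 208 * y ^ 9 + 36 * y ^ 10) by ring, abs_neg]
      _ ≤ |102 * y ^ 5| + |381 * y ^ 6| + |600 * y ^ 7| + |492 * y ^ 8| + |208 * y ^ 9| + |36 * y ^ 10| := by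
          refine (abs_add_le _ _).trans ?_
          gcongr
          refine (abs_add_le _ _).trans ?_
          gcongr
          refine (abs_add_le _ _).trans ?_
          gcongr
          refine (abs_add_le _ _).trans ?_
          gcongr
          exact abs_add_le _ _
      _ = 102 * (y ^ 4 * |y|) + 381 * y ^ 6 + 600 * (y ^ 6 * |y|) + 492 * y ^ 8 + 208 * (y ^ 8 * |y|) + 36 * y ^ 10 := by
          rw [abs_mul, abs_mul, abs_mul, abs_mul, abs_mul, abs_mul, abs_of_pos (by norm_num : (0:ℝ) < 102),
            abs_of_pos (by norm_num : (0:ℝ) < 381), abs_of_pos (by norm_num : (0:ℝ) < 600),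
            abs_of_pos (by norm_num : (0:ℝ) < 492), abs_of_pos (by norm_num : (0:ℝ) < 208),
            abs_of_pos (by norm_num : (0:ℝ) < 36), e5, e7, e9, abs_of_nonneg h6, abs_of_nonneg h8, abs_of_nonneg h10]
      _ ≤ 102 * ((lam * y ^ 4 + y ^ 4 * y ^ 2 / lam) / 2) + 381 * y ^ 6 + 600 * ((lam * y ^ 6 + y ^ 6 * y ^ 2 / lam) / 2) +
          492 * y ^ 8 + 208 * ((lam * y ^ 8 + y ^ 8 * y ^ 2 / lam) / 2) + 36 * y ^ 10 := by linarith
      _ = 0 + 0 * (u - a) ^ 2 + 51 * lam / a ^ 4 * (u - a) ^ 4 + (51 / lam + 381 + 300 * lam) / a ^ 6 * (u - a) ^ 6 +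
          (300 / lam + 492 + 104 * lam) / a ^ 8 * (u - a) ^ 8 + (104 / lam + 36) / a ^ 10 * (u - a) ^ 10 := by
          rw [e]; field_simp; ring
  have hsup : ∀ u ∈ Ioo 0 (a / 2), |r u| ≤ 1819 := by
    intro u hu
    simp only [hr]
    set y := (u - a) / a with hy
    have hy1 : |y| ≤ 1 := abs_y_le_one ha0 hu
    have hy0 := abs_nonneg y
    have hp : ∀ n : ℕ, |y| ^ n ≤ 1 := fun n => pow_le_one₀ hy0 hy1
    calc |-y ^ 5 * (102 + 381 * y + 600 * y ^ 2 + 492 * y ^ 3 + 208 * y ^ 4 + 36 * y ^ 5)|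
        = |y| ^ 5 * |102 + 381 * y + 600 * y ^ 2 + 492 * y ^ 3 + 208 * y ^ 4 + 36 * y ^ 5| := by
          rw [abs_mul, abs_neg, abs_pow]
      _ ≤ 1 * (102 + 381 * |y| + 600 * |y| ^ 2 + 492 * |y| ^ 3 + 208 * |y| ^ 4 + 36 * |y| ^ 5) := by
          refine mul_le_mul (hp 5) ?_ (abs_nonneg _) (by norm_num)
          calc |102 + 381 * y + 600 * y ^ 2 + 492 * y ^ 3 + 208 * y ^ 4 + 36 * y ^ 5|
              ≤ |102 + 381 * y + 600 * y ^ 2 + 492 * y ^ 3 + 208 * y ^ 4| + |36 * y ^ 5| := abs_add_le _ _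
            _ ≤ |102 + 381 * y + 600 * y ^ 2 + 492 * y ^ 3| + |208 * y ^ 4| + |36 * y ^ 5| := by
                gcongr; exact abs_add_le _ _
            _ ≤ |102 + 381 * y + 600 * y ^ 2| + |492 * y ^ 3| + |208 * y ^ 4| + |36 * y ^ 5| := by
                gcongr; exact abs_add_le _ _
            _ ≤ |102 + 381 * y| + |600 * y ^ 2| + |492 * y ^ 3| + |208 * y ^ 4| + |36 * y ^ 5| := by
                gcongr; exact abs_add_le _ _
            _ ≤ |(102 : ℝ)| + |381 * y| + |600 * y ^ 2| + |492 * y ^ 3| + |208 * y ^ 4| + |36 * y ^ 5| := by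
                gcongr; exact abs_add_le _ _
            _ = 102 + 381 * |y| + 600 * |y| ^ 2 + 492 * |y| ^ 3 + 208 * |y| ^ 4 + 36 * |y| ^ 5 := by
                rw [abs_of_pos (by norm_num : (0:ℝ) < 102), abs_mul, abs_mul, abs_mul, abs_mul, abs_mul,
                  abs_of_pos (by norm_num : (0:ℝ) < 381), abs_of_pos (by norm_num : (0:ℝ) < 600),
                  abs_of_pos (by norm_num : (0:ℝ) < 492), abs_of_pos (by norm_num : (0:ℝ) < 208),
                  abs_of_pos (by norm_num : (0:ℝ) < 36), abs_pow, abs_pow, abs_pow, abs_pow]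
      _ ≤ 1819 := by nlinarith [hp 1, hp 2, hp 3, hp 4, hp 5]
  have h := remainder_integral_le s hs 6 (by norm_num) (r := r) le_rfl le_rfl (by positivity) (by positivity)
    (by positivity) (by positivity) hmaj hsup
  have hL := leftRegion_le s hs 6 (by norm_num)
  rw [← ha_def] at h hL
  simp only [zero_mul, zero_add] at h
  calc |∫ u in Ioi 0, deBruijnPhi u * u ^ (s - 6) * r u|
      ≤ (2 / a) ^ 6 * (51 * lam / a ^ 4 * xiAbsMoment s 4 a + (51 / lam + 381 + 300 * lam) / a ^ 6 * xiAbsMoment s 6 a +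
          (300 / lam + 492 + 104 * lam) / a ^ 8 * xiAbsMoment s 8 a + (104 / lam + 36) / a ^ 10 * xiAbsMoment s 10 a) +
          1819 * ∫ u in Ioo 0 (a / 2), deBruijnPhi u * u ^ (s - 6) := h
    _ ≤ _ := by linarith

end Summit.RiemannHypothesis.RiemannHypothesis.Theorems.JensenPolynomials.SkewFar

end
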